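import Literature.NumberTheory.LFunctions.Zhang2022.Section10Lemma102Windows
import Literature.NumberTheory.LFunctions.Zhang2022.SkeletonLemma102RelW
import Literature.NumberTheory.LFunctions.Zhang2022.AppendixALemma83Edge
import HarnessLib

/-!
# Zhang (2022), Lemma 10.2 in the reading of record RT-01′ (`Skeleton.Lemma102RelW`) is a THEOREM
# modulo Lemma 8.3 (relative) — i.e. modulo the two Appendix-A leaves

Topic `Literature/NumberTheory/LFunctions/Zhang2022` (Landau–Siegel audit tree; verdict-neutral).
Y. Zhang, *Discrete mean estimates and the Landau–Siegel zero*, arXiv:2211.02515v1 (2022)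
[Zhang2022LandauSiegel] — **an unrefereed manuscript under adjudication**; DAG nodes `Z22:Lem10.2`,
`Z22:(10.8)`–`Z22:(10.11)` [Z22 pp.55–56, tex L2789–L2868]; campaign rows G-d43-1, G-d60-1; ZHANG-L
discharge lane (WP10), leaf `h102` of `Skeleton.theorem1_of_leaves_v19`, re-typed ONE-FOR-ONE to
`Skeleton.Lemma102RelW c′` by the lead's rulings R-13/R-24/R-26 (HOME/RETYPE-LEDGER RT-01′; statement
file `SkeletonLemma102RelW`, zl-w10-typer).

THE CLOSER (this file): `Skeleton.lemma102RelW_of_lemma83Rel : Lemma83Rel c′ → Lemma102RelW c′` and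
`Skeleton.lemma102RelW_of_parts : StepA_u007_analytic c′ → StepA_u007_read c′ → Lemma102RelW c′`
(the two Appendix-A leaves `hAn`/`hRead` of v19 give `Lemma83Rel c′` by `Lemma83.lemma83Rel_of_parts`).
Inputs, all kernel theorems of the tree: LEMMA A `Lemma102.logMeanRel_of_lemma83Rel`
(`Section10Lemma102LogMean`; = `Typed.Sec10Rel.LogMean0Rel c′`, `logMean0Rel_of_lemma83Rel`), the
window bound `Lemma102.frakv2_windows_le_of_lemma83Rel` (`Section10Lemma102Windows`;
= `Typed.Sec10Rel.Eq1011RelD c′` after `log T = 𝓛^{1.1}`, `log P = 𝓛⁹`, `eq1011RelD_of_lemma83Rel`),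
and the typer's assembly `Skeleton.lemma102RelW_of_logMean0Rel` (∘ sz-d43's
`Section10Lemma102Steps`). So in the skeleton re-thread (zl-skel, v2x):
`h102 c′ hc′ := Skeleton.lemma102RelW_of_parts (hAn c′ hc′) (hRead c′ hc′)` — the leaf LEAVES the
frontier with no new hypothesis (same disposition as `h84 := lemma84Rel_of_lemma83Rel h83`).

vs PRINT (RETYPE-LEDGER RT-01′): clauses (10.8)–(10.10) in the relative-error reading (G-d43-1);
clause (10.11) WEAKER than print (loses uniformity and rate: `C·𝓛(1+log T)⁴/log P·R(d,r)` instead of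
`≪ 𝓛⁻⁷`; G-d60-1); the consumer §18 (`Ded183RelW`) is re-proved against this reading by the strike
seat. Theorem-only; no definitions, no named facts. Nothing about the manuscript's Theorems 1–2 or
about Landau–Siegel zeros is asserted.

## References

* Y. Zhang, arXiv:2211.02515v1 (2022), §10 Lemma 10.2 (10.8)–(10.11), pp. 55–56; App. A p. 101.
  [cite: Zhang2022LandauSiegel, §10 Lemma 10.2]
-/

noncomputable section

open Complex Real Finset

namespace Literature.NumberTheory.LFunctions.Zhang2022.Lemma102

open Skeleton

/-- **LEMMA A as the typed reading `Typed.Sec10Rel.LogMean0Rel`** (the shift-0 log-mean estimate,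
relative form) from Lemma 8.3 (relative form) — `Lemma102.logMeanRel_of_lemma83Rel` restated BY NAME.
[cite: Zhang2022LandauSiegel, §10 Lemma 10.2 proof p.56; §8 Lemma 8.4 p.47] -/
theorem logMean0Rel_of_lemma83Rel {c' : ℝ} (h83 : Lemma83Rel c') : Typed.Sec10Rel.LogMean0Rel c' :=
  logMeanRel_of_lemma83Rel h83

/-- **The window clause (10.11) in the reading of record `Typed.Sec10Rel.Eq1011RelD`** from Lemma 8.3
(relative form): `Lemma102.frakv2_windows_le_of_lemma83Rel` with `log T = 𝓛^{1.1}`, `log P = 𝓛⁹`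
(`Typed.Sec10A.mem_edgeWindows_iff` for the window hypothesis).
[cite: Zhang2022LandauSiegel, §10 Lemma 10.2 (10.11) p.55] -/
theorem eq1011RelD_of_lemma83Rel {c' : ℝ} (h83 : Lemma83Rel c') : Typed.Sec10Rel.Eq1011RelD c' := by
  obtain ⟨C, D₀, h⟩ := frakv2_windows_le_of_lemma83Rel h83
  refine ⟨C, D₀, fun D _ χ hD hq hp hA j hj d r hd hr hw => ?_⟩
  have hb := h D χ hD hq hp hA j hj d r hd hr ((Typed.Sec10A.mem_edgeWindows_iff D _).mp hw)
  have hT : Real.log (bigT D) = ell D ^ (1.1 : ℝ) := by rw [bigT, Real.log_exp]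
  have hP : Real.log (bigP D) = ell D ^ 9 := by rw [bigP, Real.log_exp]
  rw [hT, hP, div_eq_mul_inv]
  calc _ ≤ C * (ell D * (1 + ell D ^ (1.1 : ℝ)) ^ 4 * (ell D ^ 9)⁻¹) *
        (∏ q ∈ (d * r).primeFactors, (1 - (q : ℝ)⁻¹)⁻¹) ^ 2 := hb
    _ = _ := by ring

end Literature.NumberTheory.LFunctions.Zhang2022.Lemma102

namespace Literature.NumberTheory.LFunctions.Zhang2022.Skeleton

/-- **Lemma 10.2 in the reading of record RT-01′ holds modulo Lemma 8.3 (relative form)**: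
`Skeleton.Lemma83Rel c′ → Skeleton.Lemma102RelW c′` (LEMMA A + the derivable window bound, assembled by
`Skeleton.lemma102RelW_of_logMean0Rel`). [cite: Zhang2022LandauSiegel, §10 Lemma 10.2 pp.55–56] -/
theorem lemma102RelW_of_lemma83Rel {c' : ℝ} (h83 : Lemma83Rel c') : Lemma102RelW c' :=
  lemma102RelW_of_logMean0Rel (hA := Lemma102.logMean0Rel_of_lemma83Rel h83)
    (h11 := Lemma102.eq1011RelD_of_lemma83Rel h83)

/-- **The closer for leaf `h102` (RT-01′) from the two Appendix-A leaves**: for every `c′`,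
`StepA_u007_analytic c′ → StepA_u007_read c′ → Skeleton.Lemma102RelW c′`
(`Lemma83.lemma83Rel_of_parts` ∘ `lemma102RelW_of_lemma83Rel`). In the whole-DAG theorem:
`h102 c′ hc′ := lemma102RelW_of_parts (hAn c′ hc′) (hRead c′ hc′)`.
[cite: Zhang2022LandauSiegel, §10 Lemma 10.2; App. A p.101] -/
theorem lemma102RelW_of_parts {c' : ℝ} (hAn : Typed.AppendixA1.StepA_u007_analytic c')
    (hRead : Typed.AppendixA1.StepA_u007_read c') : Lemma102RelW c' :=
  lemma102RelW_of_lemma83Rel (Lemma83.lemma83Rel_of_parts c' hAn hRead)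

/-- Both §8–§10 leaves of the relative family leave the frontier through `Lemma83Rel` at once:
`Lemma83Rel c′ → Lemma84Rel c′ ∧ Lemma102RelW c′`. [cite: Zhang2022LandauSiegel, §8 Lemma 8.4, §10 Lemma 10.2] -/
theorem lemma84Rel_and_lemma102RelW_of_lemma83Rel {c' : ℝ} (h83 : Lemma83Rel c') :
    Lemma84Rel c' ∧ Lemma102RelW c' :=
  ⟨lemma84Rel_of_lemma83Rel h83, lemma102RelW_of_lemma83Rel h83⟩

end Literature.NumberTheory.LFunctions.Zhang2022.Skeleton
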